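import Summits.BirchSwinnertonDyer.BirchSwinnertonDyer.Theorems.PrintCf2SplitBadTwoLevelLiftingWstar
import Summits.BirchSwinnertonDyer.BirchSwinnertonDyer.Theorems.PrintCf2SplitBadTwoRestrictedSelmerEigenProjector
import Summits.BirchSwinnertonDyer.Rank1Residual.X11b.AnticyclotomicCoinvariants
import HarnessLib

/-!
# Crux `PrintCf2.SplitBadTwoRankOneOfFacts` (stmt-BirchSwinnertonDyer-20368), road α v10.3, S3c residual (R-TOP) = brick B17:
# (LS) — the level-`K` local surjectivity for the CM summand `E[𝔮^∞]` in the `ResKernel`/decomposition-group currency of p668156 —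
# from `levelLiftingP_of_proj` (p671390)

Cell `bsd-print-cf2`, EXTRA WIDTH seat `bsd-line-cf2-p1-w4` g9 (prover-bsd-line-cf2-p1-w4-g9-0); `--supports stmt-BirchSwinnertonDyer-20368`
(helper, Theses-free). HONEST FRAMING: nothing here closes the crux or a registered stub; BSD is not proved by any of this; no summit statement
is proved by this seat. No definition, no named fact, no `sorry`. CONDITIONAL on the cited fact `poitouTate_selmerStructure_duality K`.

WHAT. **`locSurj_of_proj`**: for an elliptic `V` over a totally complex `K`, a prime `p`, places `𝔭 ≠ 𝔮` above `p`, a CM splitting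
`E[p^∞] = E[𝔮^∞] ⊕ E[𝔮̄^∞]` (`e`, `e′`, -w7 g2), GRANTED (i) the finiteness of the `E[𝔮̄^∞]`-part of Castella's relaxed conjugate groups
(`hfin'`, for every finite `R` away from `p` — hfinB′-currency), (ii) a bound on `E[p^∞]^{Γ_{K_𝔮}}` (`hfix`), (iii) level cyclicity of the summand
(`hcyc`): for every finite `S ⊆ {w ∤ p} ∪ {𝔭}` and every family `τ_w ∈ H¹(D_w, E[𝔮^∞])` there is `g ∈ H¹(Γ_K, E[𝔮^∞])` with `res_{D_w} g = τ_w` on `S`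
and `res_{D_w} g = 0` at every other `w ∤ p` — EXACTLY hypothesis (LS) of p668156's `natCard_endCoinvariants_eq_one_of_frame_of_locSurj`. Mechanism:
push the family into `E[p^∞]` (`ι_*`) and to the completions (`inflDecomp`), make it `H¹(j)`-stable (`map_restrictField_inflDecomp`: `H¹(j) ∘ infl =
infl ∘ j_*`, and `j_* ι_* = ι_*`), apply p671390, read the global class back on decomposition groups (X11b `resSubgroup_decomp_eq_of_localization_eq`,
`…_eq_zero_of_localization_eq_zero` with `localization_map_primaryInclusion_eq_zero_of_mem_upperStructureP`), and project with `e_*` (retraction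
`e_* ι_* = id` over `D_w`, -w7 g2 `resH1Hom_proj_comp_subtype`).
presearch: JSW17 Prop. 3.3.2 / Lemma 3.3.3; no new fact. beyond-print theorem: no.

References: [JetchevSkinnerWan2017] Prop. 3.3.2, Lemma 3.3.3; [GreenbergLNM1716] §2, §4; [SerreGaloisCohomology1997] I §2.4–2.5.
-/

noncomputable section

open scoped Classical

set_option linter.dupNamespace false
set_option autoImplicit false

open CategoryTheory Function Field NumberField IsDedekindDomain
open Literature.NumberTheory.EllipticCurves Literature.NumberTheory.EllipticCurves.GreenbergSelmer
open Literature.NumberTheory.GaloisRepresentations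
open Literature.NumberTheory.GaloisCohomology
open scoped ContRepresentation
open Summit.BirchSwinnertonDyer.Rank1Residual.X11b
open Summit.BirchSwinnertonDyer.Rank1Residual.X11b.LocBridge
open Summit.BirchSwinnertonDyer.Rank1Residual.X11b.Levels
open Summit.BirchSwinnertonDyer.Rank1Residual.X11b.AcSelmer
open Summit.BirchSwinnertonDyer.Rank1Residual.X11b.Coinv
open Summit.BirchSwinnertonDyer.BirchSwinnertonDyer.Theorems.PrintCf2

namespace Summit.BirchSwinnertonDyer.BirchSwinnertonDyer.Theorems.PrintCf2.LevelEigen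

/-! ## §1. Naturality of the inflation to the completion in the coefficient module -/

section Infl

variable {K : Type} [Field K] [NumberField K]
  {M : Type} [AddCommGroup M] [DistribMulAction (absoluteGaloisGroup K) M] [TopologicalSpace M] [DiscreteTopology M]
  (hM : ∀ m : M, IsOpen {σ : absoluteGaloisGroup K | σ • m = m})

/-- **`H¹(j) ∘ inflDecomp = inflDecomp ∘ j_*`** for an equivariant additive endomorphism `f` of `M` and any continuous intertwining `j` agreeing with it
pointwise (on cocycles both sides are `σ ↦ f (φ (σ|_{D_v}))`). [cite: SerreGaloisCohomology1997, I §2.4] -/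
theorem map_restrictField_inflDecomp (v : HeightOneSpectrum (𝓞 K)) (f : M →+ M)
    (hf : ∀ (σ : absoluteGaloisGroup K) (m : M), f (σ • m) = σ • f m)
    (j : (ofSMul M hM).toContRepresentation →ⁱL (ofSMul M hM).toContRepresentation) (hj : ∀ m, j m = f m)
    (y : subgroupH1 (decomp (K := K) v) M) :
    galoisCohomology.map (j.restrictField (Place.Completion (Sum.inr v : Place K))) 1 (inflDecomp hM v y) =
      inflDecomp hM v (resH1Hom (ContinuousMonoidHom.id (decomp (K := K) v)) f (fun σ m ↦ hf σ m) y) := by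
  obtain ⟨φ, rfl⟩ := oneCocycleClass_surjective _ y
  rw [inflDecomp, AddMonoidHom.comp_apply, AddMonoidHom.comp_apply, resH1Hom_oneCocycleClass, resOfLe,
    resH1Hom_oneCocycleClass, resH1Hom_oneCocycleClass, inflToCompletion_oneCocycleClass, inflToCompletion_oneCocycleClass]
  refine (galoisCohomology.map_one_oneCocycleClass _ _).trans ?_
  congr 1
  refine Subtype.ext (ContinuousMap.ext fun σ ↦ ?_)
  exact hj _

end Infl

/-! ## §2. (LS) for `E[𝔮^∞]` from `levelLiftingP_of_proj` -/

section LS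

variable {K : Type} [Field K] [NumberField K] (V : WeierstrassCurve K) [V.IsElliptic] (p : ℕ)
  [Fact p.Prime] (π : V.endRing) (r r' : ℤ_[p]) (𝔭 : HeightOneSpectrum (𝓞 K))

/-- **(LS) for the CM summand** — hypothesis `hLS` of p668156's `natCard_endCoinvariants_eq_one_of_frame_of_locSurj`, from the Poitou–Tate surgery
p671390 `levelLiftingP_of_proj` (cited fact `poitouTate_selmerStructure_duality K`), GRANTED: the CM splitting `e`, `e′`; the finiteness of the
`E[𝔮̄^∞]`-parts `H¹(j′)(H¹_{𝓛^{ac,R}_𝔮}(K, E[p^∞]))` for all finite `R` away from `p`; a bound on `E[p^∞]^{Γ_{K_𝔮}}`; level cyclicity of `E[𝔮^∞]`.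
[cite: JetchevSkinnerWan2017, Prop. 3.3.2 and Lemma 3.3.3 (arXiv:1512.06894 pp. 11–12)] [cite: GreenbergLNM1716, §4 pp. 122–125] -/
theorem locSurj_of_proj [IsTotallyComplex K] (hPT : poitouTate_selmerStructure_duality K)
    (e : V.geomPrimaryTorsion p →+ ↥(V.endEigenPrimaryTorsion p π r))
    (e' : V.geomPrimaryTorsion p →+ ↥(V.endEigenPrimaryTorsion p π r'))
    (he₁ : ∀ x : ↥(V.endEigenPrimaryTorsion p π r), e x = x)
    (he : ∀ (σ : absoluteGaloisGroup K) (x : V.geomPrimaryTorsion p), e (σ • x) = σ • e x)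
    (he'₁ : ∀ x : ↥(V.endEigenPrimaryTorsion p π r'), e' x = x)
    (he' : ∀ (σ : absoluteGaloisGroup K) (x : V.geomPrimaryTorsion p), e' (σ • x) = σ • e' x)
    (hsum : ∀ x, (e x : V.geomPrimaryTorsion p) + (e' x : V.geomPrimaryTorsion p) = x)
    (hcyc : ∀ (N : ℕ) (eN : (V.torsionGaloisModule ((p ^ N : ℕ) : ℤ)).toContRepresentation →ⁱL
        (V.torsionGaloisModule ((p ^ N : ℕ) : ℤ)).toContRepresentation),
      (∀ x, primaryInclusion V p N (eN x) ∈ V.endEigenPrimaryTorsion p π r) →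
        ∃ g : V.geomTorsion ((p ^ N : ℕ) : ℤ), ∀ x, ∃ a : ℤ, eN x = a • g)
    (j' : (primaryGaloisModule V p).toContRepresentation →ⁱL (primaryGaloisModule V p).toContRepresentation)
    (hj' : ∀ x, j' x = (e' x : V.geomPrimaryTorsion p))
    {𝔮 : HeightOneSpectrum (𝓞 K)} (h𝔭 : ((p : ℕ) : 𝓞 K) ∈ 𝔭.asIdeal) (h𝔮 : ((p : ℕ) : 𝓞 K) ∈ 𝔮.asIdeal) (hne : 𝔮 ≠ 𝔭)
    (hfin' : ∀ R : Set (HeightOneSpectrum (𝓞 K)), R.Finite → (∀ v ∈ R, ((p : ℕ) : 𝓞 K) ∉ v.asIdeal) →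
      Finite (((acStructure (primaryGaloisModule V p) p 𝔮 R).selmerGroup).map (galoisCohomology.map j' 1)))
    (hfix : ∃ m : ℕ, ∀ Q : V.geomPrimaryTorsion p,
      (∀ σ : absoluteGaloisGroup (𝔮.adicCompletion K),
        GaloisRep.restrictField (𝔮.adicCompletion K) (primaryGaloisModule V p) σ Q = Q) → p ^ m • Q = 0)
    (S : Finset (HeightOneSpectrum (𝓞 K))) (hS : ∀ w ∈ S, ((p : ℕ) : 𝓞 K) ∉ w.asIdeal ∨ w = 𝔭)
    (τ : (w : HeightOneSpectrum (𝓞 K)) → subgroupH1 (decomp (K := K) w) ↥(V.endEigenPrimaryTorsion p π r)) :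
    ∃ g : discreteH1 (absoluteGaloisGroup K) ↥(V.endEigenPrimaryTorsion p π r),
      (∀ w ∈ S, ResKernel.resSubgroup (decomp (K := K) w) ↥(V.endEigenPrimaryTorsion p π r) g = τ w) ∧
      (∀ w : HeightOneSpectrum (𝓞 K), w ∉ S → ((p : ℕ) : 𝓞 K) ∉ w.asIdeal →
        ResKernel.resSubgroup (decomp (K := K) w) ↥(V.endEigenPrimaryTorsion p π r) g = 0) := by
  haveI : CompactSpace (absoluteGaloisGroup K) := absoluteGaloisGroup_compactSpace K
  have hM : ∀ m : V.geomPrimaryTorsion p, IsOpen {σ : absoluteGaloisGroup K | σ • m = m} :=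
    isOpen_stabilizer_geomPrimaryTorsion V p
  -- the endomorphism `j = ι ∘ e` of `E[p^∞]`
  have hjf : ∀ (σ : absoluteGaloisGroup K) (x : V.geomPrimaryTorsion p),
      ((V.endEigenPrimaryTorsion p π r).subtype.comp e) (σ • x) = σ • ((V.endEigenPrimaryTorsion p π r).subtype.comp e) x :=
    fun σ x ↦ by
      simp only [AddMonoidHom.comp_apply, AddSubgroup.coe_subtype, he, WeierstrassCurve.endEigenPrimaryTorsion.coe_smul]
  obtain ⟨j, hj⟩ := exists_primaryEndo V p ((V.endEigenPrimaryTorsion p π r).subtype.comp e) hjf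
  -- the set `Σ = S ∖ {𝔭}` (away from `p`) and the finite set of places `T`
  set Sig : Set (HeightOneSpectrum (𝓞 K)) := {w | w ∈ S ∧ w ≠ 𝔭} with hSig
  have hSigfin : Sig.Finite := S.finite_toSet.subset fun w hw ↦ hw.1
  have hSigp : ∀ v ∈ Sig, ((p : ℕ) : 𝓞 K) ∉ v.asIdeal := fun v hv ↦ (hS v hv.1).resolve_right hv.2
  have hp0 : p ≠ 0 := (Fact.out : p.Prime).ne_zero
  have hbadfin : {v : HeightOneSpectrum (𝓞 K) | ¬ V.HasGoodReductionAt v}.Finite := by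
    have h := V.eventually_hasGoodReductionAt
    rwa [Filter.eventually_cofinite] at h
  set T : Finset (Place K) := (Finset.univ.image Sum.inl) ∪
    (((H2Support.finite_setOf_natCast_mem (K := K) p hp0).toFinset ∪ hSigfin.toFinset ∪ hbadfin.toFinset).image Sum.inr) with hT
  have hinf : ∀ w : InfinitePlace K, (Sum.inl w : Place K) ∈ T := fun w ↦
    Finset.mem_union_left _ (Finset.mem_image_of_mem _ (Finset.mem_univ w))
  have hpT : ∀ v : HeightOneSpectrum (𝓞 K), ((p : ℕ) : 𝓞 K) ∈ v.asIdeal → (Sum.inr v : Place K) ∈ T := fun v hv ↦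
    Finset.mem_union_right _ (Finset.mem_image_of_mem _
      (Finset.mem_union_left _ (Finset.mem_union_left _ ((Set.Finite.mem_toFinset _).mpr hv))))
  have hSigT : ∀ v ∈ Sig, (Sum.inr v : Place K) ∈ T := fun v hv ↦
    Finset.mem_union_right _ (Finset.mem_image_of_mem _
      (Finset.mem_union_left _ (Finset.mem_union_right _ ((Set.Finite.mem_toFinset _).mpr hv))))
  have hbad : ∀ v : HeightOneSpectrum (𝓞 K), ¬ V.HasGoodReductionAt v → (Sum.inr v : Place K) ∈ T := fun v hv ↦
    Finset.mem_union_right _ (Finset.mem_image_of_mem _ (Finset.mem_union_right _ ((Set.Finite.mem_toFinset _).mpr hv)))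
  -- the relaxed conjugate finiteness on `R = {v ∈ T : v ∤ p}`
  have hRfin : {v : HeightOneSpectrum (𝓞 K) | (Sum.inr v : Place K) ∈ T ∧ ((p : ℕ) : 𝓞 K) ∉ v.asIdeal}.Finite :=
    (T.finite_toSet.preimage Sum.inr_injective.injOn).subset fun v hv ↦ hv.1
  have hfinR := hfin' _ hRfin (fun v hv ↦ hv.2)
  -- the family pushed into `E[p^∞]` and to the completions
  let ι : ∀ w : HeightOneSpectrum (𝓞 K), subgroupH1 (decomp (K := K) w) ↥(V.endEigenPrimaryTorsion p π r) →+
      subgroupH1 (decomp (K := K) w) (V.geomPrimaryTorsion p) :=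
    fun w ↦ resH1Hom (ContinuousMonoidHom.id (decomp (K := K) w)) (V.endEigenPrimaryTorsion p π r).subtype (fun _ _ ↦ rfl)
  let τE : ∀ v : (insert 𝔭 Sig : Set (HeightOneSpectrum (𝓞 K))),
      galoisCohomology ((primaryGaloisModule V p).toLocal (Sum.inr (v : HeightOneSpectrum (𝓞 K)))) 1 :=
    fun v ↦ inflDecomp hM (v : HeightOneSpectrum (𝓞 K)) (ι v (τ v))
  obtain ⟨K₀, hK₀⟩ := exists_pow_nsmul_family_eq_zero (W := V) (p := p) (hSigfin.insert 𝔭) τE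
  have hτj : ∀ v : (insert 𝔭 Sig : Set (HeightOneSpectrum (𝓞 K))),
      galoisCohomology.map (j.restrictField (Place.Completion (Sum.inr (v : HeightOneSpectrum (𝓞 K)) : Place K))) 1 (τE v) = τE v := by
    intro v
    change galoisCohomology.map _ 1 (inflDecomp hM (v : HeightOneSpectrum (𝓞 K)) (ι v (τ v))) = inflDecomp hM _ (ι v (τ v))
    refine (map_restrictField_inflDecomp hM (v : HeightOneSpectrum (𝓞 K)) ((V.endEigenPrimaryTorsion p π r).subtype.comp e) hjf j hj
      _).trans ?_
    congr 1
    -- `j_* ι_* = ι_*` on `H¹(D_v, ·)`: `e ∘ ι = id`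
    have hcomp := congrArg (fun f ↦ f (τ v)) (resH1Hom_comp (ContinuousMonoidHom.id (decomp (K := K) (v : HeightOneSpectrum (𝓞 K))))
      (V.endEigenPrimaryTorsion p π r).subtype
      (fun _ _ ↦ rfl) (ContinuousMonoidHom.id _) ((V.endEigenPrimaryTorsion p π r).subtype.comp e) (fun σ m ↦ hjf σ m))
    simp only [AddMonoidHom.comp_apply] at hcomp
    rw [hcomp]
    have hφ : (ContinuousMonoidHom.id (decomp (K := K) (v : HeightOneSpectrum (𝓞 K)))).comp (ContinuousMonoidHom.id _) =
        ContinuousMonoidHom.id _ := ContinuousMonoidHom.ext fun _ ↦ rfl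
    have hψ : ((V.endEigenPrimaryTorsion p π r).subtype.comp e).comp (V.endEigenPrimaryTorsion p π r).subtype =
        (V.endEigenPrimaryTorsion p π r).subtype := AddMonoidHom.ext fun x ↦ by
      rw [AddMonoidHom.comp_apply, AddMonoidHom.comp_apply, AddSubgroup.coe_subtype, he₁ x]
    rw [resH1Hom_congr hφ hψ _ (fun _ _ ↦ rfl)]
  -- Poitou–Tate surgery
  obtain ⟨N, x, hx, hloc⟩ := levelLiftingP_of_proj V p π r r' 𝔭 Sig T hPT (fun w ↦ IsTotallyComplex.isComplex w) e e' he₁ he he'₁ he'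
    hsum hcyc j j' hj hj' h𝔭 h𝔮 hne hSigp hinf hpT hSigT hbad hfinR hfix K₀ τE hK₀ hτj
  set G := galoisCohomology.map (primaryInclusion V p N) 1 x with hG
  -- the global `E[𝔮^∞]`-class: project with `e_*`
  refine ⟨resH1Hom (ContinuousMonoidHom.id (absoluteGaloisGroup K)) e (fun σ m ↦ he σ m) (toDiscreteH1 hM G), fun w hw ↦ ?_, fun w hwS hpw ↦ ?_⟩
  · -- on `S`: `res_{D_w} (e_* G) = e_* (res_{D_w} G) = e_* (ι_* τ_w) = τ_w`
    have hwI : w ∈ (insert 𝔭 Sig : Set (HeightOneSpectrum (𝓞 K))) := by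
      by_cases hw𝔭 : w = 𝔭
      · exact hw𝔭 ▸ Set.mem_insert _ _
      · exact Set.mem_insert_of_mem _ ⟨hw, hw𝔭⟩
    have hres : ResKernel.resSubgroup (decomp (K := K) w) (V.geomPrimaryTorsion p) (toDiscreteH1 hM G) = ι w (τ w) :=
      resSubgroup_decomp_eq_of_localization_eq hM w G (ι w (τ w)) (hloc ⟨w, hwI⟩)
    have hnat := congrArg (fun f ↦ f (toDiscreteH1 hM G)) (ResKernel.resH1Hom_comp_resSubgroup (ContinuousMonoidHom.id (absoluteGaloisGroup K)) e
      (fun σ m ↦ he σ m) (decomp (K := K) w) (decomp (K := K) w) (ContinuousMonoidHom.id _) (fun _ ↦ rfl) (fun σ m ↦ he σ m))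
    simp only [AddMonoidHom.comp_apply] at hnat
    rw [← hnat, hres]
    have hret := congrArg (fun f ↦ f (τ w)) (RestrictedSelmerPair.resH1Hom_proj_comp_subtype V p π r (decomp (K := K) w) e he₁ he)
    simpa only [AddMonoidHom.comp_apply, AddMonoidHom.id_apply] using hret
  · -- off `S`, away from `p`: `loc_w G = 0`
    have hwSig : w ∉ Sig := fun h ↦ hwS h.1
    have h0 : galoisCohomology.localization (primaryGaloisModule V p) (Sum.inr w) 1 G = 0 :=
      localization_map_primaryInclusion_eq_zero_of_mem_upperStructureP V p N 𝔭 Sig hx h𝔭 hpw hwSig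
    have hres : ResKernel.resSubgroup (decomp (K := K) w) (V.geomPrimaryTorsion p) (toDiscreteH1 hM G) = 0 :=
      resSubgroup_decomp_eq_zero_of_localization_eq_zero hM w G h0
    have hnat := congrArg (fun f ↦ f (toDiscreteH1 hM G)) (ResKernel.resH1Hom_comp_resSubgroup (ContinuousMonoidHom.id (absoluteGaloisGroup K)) e
      (fun σ m ↦ he σ m) (decomp (K := K) w) (decomp (K := K) w) (ContinuousMonoidHom.id _) (fun _ ↦ rfl) (fun σ m ↦ he σ m))
    simp only [AddMonoidHom.comp_apply] at hnat
    rw [← hnat, hres, map_zero]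

end LS

end Summit.BirchSwinnertonDyer.BirchSwinnertonDyer.Theorems.PrintCf2.LevelEigen

end
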